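import Summits.Schanuel.Schanuel.Theorems.RootDecomp1AtomRigidityTransfer

/-!
# Rigidity of the tight atom under one-defect Schanuel (route-Schanuel-RootDecomp1, lens-1 round 8 «RigidityLayer» — tree port) — part 3 (§7, §9: tight atoms below failures, B ⟹ Real ∨ Unitary, pure cells)

Kernel theorems about the items of `route-Schanuel-RootDecomp1` (no item is restated; every hypothesis is a
live item BY NAME or plain data):

* `span_le_of_atom_of_failure` — under `DefectOneSchanuel` (B, 25020) the ℚ-span of a TIGHT ATOM (ℚ-l.i.,
  `trdeg ℚ(z,e^z) < n`, span-minimal in the span-local sense of items 29645 / 30352 / 30353) lies inside the span of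
  every failing ℚ-l.i. tuple; `atom_span_unique`; `conj_mem_span_of_atom` (the atom is conjugation-stable);
  `exists_atom_of_failure` (no hypothesis); `real_or_unitary_of_defectOne : B → 1C.RealSchanuel ∨ 1C.UnitarySchanuel`.
* span invariance of `trdeg ℚ(z,e^z)`, `ℚ(z)`, `trdeg ℚ(e^z)` under a ℚ-change of basis (`*_of_basis_change`).
* `entangled_of_axisRestricted` — `B → L → Q → U⊥ → (30352 restricted to AXIS tuples) → 30352`
  (`EntangledSaturatedEssentialSchanuel`), the restricted statement spelled out as a hypothesis (it is the lens's
  proposed round-8 residual `AxisEntangledSaturatedEssentialSchanuel`, not an item yet); `entangled_of_conjStableRestricted`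
  likewise for the conjugation-stable restriction.

Computation credit: the submodular count is lens-2 gen-0 `DefectLattice.closes_lattice` / lens-5 gen-2
`firstFailureConjStable_of_defectOne` (HOME files, global-minimality forms); the span-local form, the transfer and the
cross-route disjunction are lens-1 gen 8.  `--supports stmt-Schanuel-30352`.
-/

set_option linter.dupNamespace false

noncomputable section

namespace Summit.Schanuel.Schanuel.Theorems.RootDecomp1AtomRigidity

open Complex IntermediateField
open scoped BigOperators Cardinal ComplexConjugate
open Summit.Schanuel.Schanuel.Theses.RootDecomp1 (SchanuelTwo EssentialCounterexamplesInEcl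
  DefectOneSchanuel LinearSchanuel QuadraticSchanuel RationalImageSchanuel
  NonrationalSaturatedEssentialSchanuel EntangledSaturatedEssentialSchanuel
  DisjointSaturatedEssentialSchanuel NonrationalSaturatedEssentialSchanuelGlue)
open Summit.Schanuel.Schanuel.Theorems.RootDecomp1DefectSplit (trdeg_adjoin_le_of_isAlgebraic isAlgebraic_of_mem_gens)
open Summit.Schanuel.Schanuel.Theorems.RootDecomp1EAnchor (isAlgebraic_of_le trdeg_adjoin_sum_le_union
  trdeg_adjoin_union_le_sum)
open Summit.Schanuel.Schanuel.Theorems.RootDecomp1EntanglementSplit (nonrationalSaturatedEssentialSchanuelGlue_holds)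
open Summit.Schanuel.Schanuel.Theorems.RootDecomp1EssentialInEcl (essentialCounterexamplesInEcl_holds)
open Summit.Schanuel.Schanuel.Theorems.RootDecomp1CAxisReduction (exists_axis_tuple_of_conj_stable)
open Literature.NumberTheory.Transcendental (exists_nsmul_mem_span_int mem_adjoin_of_mem_span_int
  trdeg_adjoin_le_of_le Kirby2010_ecl_isExpSubfield_holds)

/-! ## §7  Further rigidity: existence of a tight atom below any failure; `B ⟹ RealSchanuel ∨ UnitarySchanuel` -/

/-- Below every failing ℚ-l.i. tuple there is a TIGHT ATOM (minimise the length of a failing ℚ-l.i. tuple inside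
the span). No hypothesis. -/
theorem exists_atom_of_failure {m : ℕ} {y : Fin m → ℂ} (hy : LinearIndependent ℚ y)
    (hytr : Algebra.trdeg ℚ ↥(adjoin ℚ (Set.range y ∪ Set.range (Complex.exp ∘ y))) < (m : Cardinal)) :
    ∃ (n : ℕ) (z : Fin n → ℂ), LinearIndependent ℚ z ∧ (∀ i, z i ∈ Submodule.span ℚ (Set.range y)) ∧
      Algebra.trdeg ℚ ↥(adjoin ℚ (Set.range z ∪ Set.range (Complex.exp ∘ z))) < (n : Cardinal) ∧
      (∀ (k : ℕ), k < n → ∀ (w : Fin k → ℂ), LinearIndependent ℚ w →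
        (∀ i, w i ∈ Submodule.span ℚ (Set.range z)) →
        (k : Cardinal) ≤ Algebra.trdeg ℚ ↥(adjoin ℚ (Set.range w ∪ Set.range (Complex.exp ∘ w)))) := by
  classical
  let P : ℕ → Prop := fun n => ∃ z : Fin n → ℂ, LinearIndependent ℚ z ∧
    (∀ i, z i ∈ Submodule.span ℚ (Set.range y)) ∧
    Algebra.trdeg ℚ ↥(adjoin ℚ (Set.range z ∪ Set.range (Complex.exp ∘ z))) < (n : Cardinal)
  have hex : ∃ n, P n := ⟨m, y, hy, fun i => Submodule.subset_span ⟨i, rfl⟩, hytr⟩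
  obtain ⟨z, hz, hzy, hztr⟩ := Nat.find_spec hex
  refine ⟨Nat.find hex, z, hz, hzy, hztr, ?_⟩
  intro k hk w hw hwz
  by_contra hlt
  have hzy' : Submodule.span ℚ (Set.range z) ≤ Submodule.span ℚ (Set.range y) :=
    Submodule.span_le.mpr (Set.range_subset_iff.mpr hzy)
  exact Nat.find_min hex hk ⟨w, hw, fun i => hzy' (hwz i), lt_of_not_ge hlt⟩

/-- **`B ⟹ RealSchanuel ∨ UnitarySchanuel`** (pieces of route 1C).  If both failed, the tight atom below the real
failure would lie (core lemma) inside the span of the imaginary failure as well, i.e. inside `ℝ ∩ iℝ = 0`. -/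
theorem real_or_unitary_of_defectOne (hD : DefectOneSchanuel) :
    Summit.Schanuel.Schanuel.Theses.RootDecomp1C.RealSchanuel ∨
      Summit.Schanuel.Schanuel.Theses.RootDecomp1C.UnitarySchanuel := by
  classical
  by_contra h
  push Not at h
  obtain ⟨hR, hUn⟩ := h
  -- the ℚ-linear maps r ↦ (r : ℂ) and r ↦ (r : ℂ) * I
  let ofRealQ : ℝ →ₗ[ℚ] ℂ :=
    Literature.ModelTheory.ExponentialFields.ExponentialRingHom.realComplex.toRingHom.toRatAlgHom.toLinearMap
  have ofRealQ_apply : ∀ t : ℝ, ofRealQ t = (t : ℂ) := fun t => rfl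
  have ofRealQ_inj : Function.Injective ofRealQ := fun a b hab => by
    have : ((a : ℝ) : ℂ) = ((b : ℝ) : ℂ) := by rw [← ofRealQ_apply, ← ofRealQ_apply]; exact hab
    exact Complex.ofReal_injective this
  let mulIQ : ℝ →ₗ[ℚ] ℂ := (LinearMap.mulRight ℚ Complex.I).comp ofRealQ
  have mulIQ_apply : ∀ t : ℝ, mulIQ t = (t : ℂ) * Complex.I := fun t => rfl
  have mulIQ_inj : Function.Injective mulIQ := fun a b hab => by
    have h1 : ((a : ℝ) : ℂ) * Complex.I = ((b : ℝ) : ℂ) * Complex.I := by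
      rw [← mulIQ_apply, ← mulIQ_apply]; exact hab
    exact Complex.ofReal_injective (mul_right_cancel₀ Complex.I_ne_zero h1)
  -- a real failure
  unfold Summit.Schanuel.Schanuel.Theses.RootDecomp1C.RealSchanuel
    Literature.ModelTheory.ExponentialFields.SchanuelProperty at hR
  push Not at hR
  obtain ⟨m, r, hr, hrtr⟩ := hR
  have h2 := Literature.ModelTheory.ExponentialFields.ExponentialRingHom.realComplex.lift_trdeg_adjoin_eq r
  simp only [Cardinal.lift_id] at h2
  rw [h2] at hrtr
  let x : Fin m → ℂ := fun j => ((r j : ℝ) : ℂ)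
  have hxli : LinearIndependent ℚ x := by
    have : x = ⇑ofRealQ ∘ r := by funext j; rfl
    rw [this]
    exact hr.map' ofRealQ (LinearMap.ker_eq_bot.mpr ofRealQ_inj)
  have hxtr : Algebra.trdeg ℚ ↥(adjoin ℚ (Set.range x ∪ Set.range (Complex.exp ∘ x))) < (m : Cardinal) :=
    hrtr
  -- an imaginary failure
  unfold Summit.Schanuel.Schanuel.Theses.RootDecomp1C.UnitarySchanuel at hUn
  push Not at hUn
  obtain ⟨m', r', hr', hr'tr⟩ := hUn
  let x' : Fin m' → ℂ := fun j => ((r' j : ℝ) : ℂ) * Complex.I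
  have hx'li : LinearIndependent ℚ x' := by
    have : x' = ⇑mulIQ ∘ r' := by funext j; rfl
    rw [this]
    exact hr'.map' mulIQ (LinearMap.ker_eq_bot.mpr mulIQ_inj)
  have hx'tr : Algebra.trdeg ℚ ↥(adjoin ℚ (Set.range x' ∪ Set.range (Complex.exp ∘ x'))) < (m' : Cardinal) :=
    hr'tr
  -- the tight atom below the real failure lies inside the imaginary one
  obtain ⟨n, z, hz, hzx, hztr, hmin⟩ := exists_atom_of_failure hxli hxtr
  have hzx' : Submodule.span ℚ (Set.range z) ≤ Submodule.span ℚ (Set.range x') :=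
    span_le_of_atom_of_failure hD hz hztr hmin hx'li hx'tr
  -- so every z i is real and purely imaginary, i.e. zero
  have hn : 0 < n := by
    rcases Nat.eq_zero_or_pos n with h0 | h0
    · subst h0; simp at hztr
    · exact h0
  have hVx : Submodule.span ℚ (Set.range x) ≤ LinearMap.range ofRealQ :=
    Submodule.span_le.mpr (by rintro _ ⟨j, rfl⟩; exact LinearMap.mem_range.mpr ⟨r j, rfl⟩)
  have hVx' : Submodule.span ℚ (Set.range x') ≤ LinearMap.range mulIQ :=
    Submodule.span_le.mpr (by rintro _ ⟨j, rfl⟩; exact LinearMap.mem_range.mpr ⟨r' j, rfl⟩)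
  let i₀ : Fin n := ⟨0, hn⟩
  obtain ⟨t, ht⟩ := LinearMap.mem_range.mp (hVx (hzx i₀))
  obtain ⟨t', ht'⟩ := LinearMap.mem_range.mp (hVx' (hzx' (Submodule.subset_span ⟨i₀, rfl⟩)))
  have him : (z i₀).im = 0 := by rw [← ht, ofRealQ_apply]; simp
  have hre : (z i₀).re = 0 := by rw [← ht', mulIQ_apply]; simp
  have hzero : z i₀ = 0 := Complex.ext hre him
  exact hz.ne_zero i₀ hzero

/-! ## §9  Under `B` the span-local atom IS the global first failure; pure cells of the residual vs `1C`

Bookkeeping theorems for the forest (R1/R2 convergence between this route's SPAN-LOCAL residual chain and the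
FIRST-FAILURE pieces of 1B / 1C / 1H): under `B` the span-local minimality clause carried by 29645/30352/30353 upgrades
FOR FREE to global first-failure minimality, so every first-failure theorem of the sibling routes applies to this
route's atom, and conversely. -/

/-- **Local = global under `B`.**  If `z` is a tight atom (span-minimal failure) and `B` holds, then EVERY shorter
ℚ-l.i. tuple anywhere in `ℂ` satisfies Schanuel: `z` is a first failure in the strongest sense (indeed every failure
contains `span z`, `span_le_of_atom_of_failure`). -/
theorem atom_first_failure (hD : DefectOneSchanuel) {n : ℕ} {z : Fin n → ℂ}
    (hz : LinearIndependent ℚ z)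
    (hztr : Algebra.trdeg ℚ ↥(adjoin ℚ (Set.range z ∪ Set.range (Complex.exp ∘ z))) < (n : Cardinal))
    (hmin : ∀ (k : ℕ), k < n → ∀ (w : Fin k → ℂ), LinearIndependent ℚ w →
      (∀ i, w i ∈ Submodule.span ℚ (Set.range z)) →
      (k : Cardinal) ≤ Algebra.trdeg ℚ ↥(adjoin ℚ (Set.range w ∪ Set.range (Complex.exp ∘ w)))) :
    ∀ (m : ℕ), m < n → ∀ (w : Fin m → ℂ), LinearIndependent ℚ w →
      (m : Cardinal) ≤ Algebra.trdeg ℚ ↥(adjoin ℚ (Set.range w ∪ Set.range (Complex.exp ∘ w))) := by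
  classical
  intro m hm w hw
  by_contra hlt
  have hwtr : Algebra.trdeg ℚ ↥(adjoin ℚ (Set.range w ∪ Set.range (Complex.exp ∘ w))) < (m : Cardinal) :=
    lt_of_not_ge hlt
  have hle : Submodule.span ℚ (Set.range z) ≤ Submodule.span ℚ (Set.range w) :=
    span_le_of_atom_of_failure hD hz hztr hmin hw hwtr
  haveI : FiniteDimensional ℚ ↥(Submodule.span ℚ (Set.range w)) :=
    FiniteDimensional.span_of_finite ℚ (Set.finite_range w)
  have h := Submodule.finrank_mono hle
  rw [finrank_span_eq_card hz, finrank_span_eq_card hw, Fintype.card_fin, Fintype.card_fin] at h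
  omega

/-- Under `B`, the length of a tight atom is at most the length of any failure. -/
theorem atom_length_le_of_failure (hD : DefectOneSchanuel) {n m : ℕ} {z : Fin n → ℂ} {y : Fin m → ℂ}
    (hz : LinearIndependent ℚ z)
    (hztr : Algebra.trdeg ℚ ↥(adjoin ℚ (Set.range z ∪ Set.range (Complex.exp ∘ z))) < (n : Cardinal))
    (hmin : ∀ (k : ℕ), k < n → ∀ (w : Fin k → ℂ), LinearIndependent ℚ w →
      (∀ i, w i ∈ Submodule.span ℚ (Set.range z)) →
      (k : Cardinal) ≤ Algebra.trdeg ℚ ↥(adjoin ℚ (Set.range w ∪ Set.range (Complex.exp ∘ w))))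
    (hy : LinearIndependent ℚ y)
    (hytr : Algebra.trdeg ℚ ↥(adjoin ℚ (Set.range y ∪ Set.range (Complex.exp ∘ y))) < (m : Cardinal)) :
    n ≤ m := by
  classical
  haveI : FiniteDimensional ℚ ↥(Submodule.span ℚ (Set.range y)) :=
    FiniteDimensional.span_of_finite ℚ (Set.finite_range y)
  have h := Submodule.finrank_mono (span_le_of_atom_of_failure hD hz hztr hmin hy hytr)
  rw [finrank_span_eq_card hz, finrank_span_eq_card hy, Fintype.card_fin, Fintype.card_fin] at h
  exact h

/-- **Pure-real cell.**  Under `B`, if `RealSchanuel` (1C/1B item 19278) FAILS then every tight atom is REAL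
(all coordinates real): the atom lies in the span of the real failure. -/
theorem atom_real_of_not_realSchanuel (hD : DefectOneSchanuel)
    (hR : ¬ Summit.Schanuel.Schanuel.Theses.RootDecomp1C.RealSchanuel) {n : ℕ} {z : Fin n → ℂ}
    (hz : LinearIndependent ℚ z)
    (hztr : Algebra.trdeg ℚ ↥(adjoin ℚ (Set.range z ∪ Set.range (Complex.exp ∘ z))) < (n : Cardinal))
    (hmin : ∀ (k : ℕ), k < n → ∀ (w : Fin k → ℂ), LinearIndependent ℚ w →
      (∀ i, w i ∈ Submodule.span ℚ (Set.range z)) →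
      (k : Cardinal) ≤ Algebra.trdeg ℚ ↥(adjoin ℚ (Set.range w ∪ Set.range (Complex.exp ∘ w)))) :
    ∀ i, (z i).im = 0 := by
  classical
  let ofRealQ : ℝ →ₗ[ℚ] ℂ :=
    Literature.ModelTheory.ExponentialFields.ExponentialRingHom.realComplex.toRingHom.toRatAlgHom.toLinearMap
  have ofRealQ_apply : ∀ t : ℝ, ofRealQ t = (t : ℂ) := fun t => rfl
  have ofRealQ_inj : Function.Injective ofRealQ := fun a b hab => by
    have : ((a : ℝ) : ℂ) = ((b : ℝ) : ℂ) := by rw [← ofRealQ_apply, ← ofRealQ_apply]; exact hab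
    exact Complex.ofReal_injective this
  unfold Summit.Schanuel.Schanuel.Theses.RootDecomp1C.RealSchanuel
    Literature.ModelTheory.ExponentialFields.SchanuelProperty at hR
  push Not at hR
  obtain ⟨m, r, hr, hrtr⟩ := hR
  have h2 := Literature.ModelTheory.ExponentialFields.ExponentialRingHom.realComplex.lift_trdeg_adjoin_eq r
  simp only [Cardinal.lift_id] at h2
  rw [h2] at hrtr
  let x : Fin m → ℂ := fun j => ((r j : ℝ) : ℂ)
  have hxli : LinearIndependent ℚ x := by
    have : x = ⇑ofRealQ ∘ r := by funext j; rfl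
    rw [this]
    exact hr.map' ofRealQ (LinearMap.ker_eq_bot.mpr ofRealQ_inj)
  have hxtr : Algebra.trdeg ℚ ↥(adjoin ℚ (Set.range x ∪ Set.range (Complex.exp ∘ x))) < (m : Cardinal) :=
    hrtr
  have hzx : Submodule.span ℚ (Set.range z) ≤ Submodule.span ℚ (Set.range x) :=
    span_le_of_atom_of_failure hD hz hztr hmin hxli hxtr
  have hVx : Submodule.span ℚ (Set.range x) ≤ LinearMap.range ofRealQ :=
    Submodule.span_le.mpr (by rintro _ ⟨j, rfl⟩; exact LinearMap.mem_range.mpr ⟨r j, rfl⟩)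
  intro i
  obtain ⟨t, ht⟩ := LinearMap.mem_range.mp (hVx (hzx (Submodule.subset_span ⟨i, rfl⟩)))
  rw [← ht, ofRealQ_apply]; simp

/-- **Pure-imaginary cell.**  Under `B`, if `UnitarySchanuel` (1C/1B item 24624) FAILS then every tight atom is
PURELY IMAGINARY. -/
theorem atom_imaginary_of_not_unitarySchanuel (hD : DefectOneSchanuel)
    (hUn : ¬ Summit.Schanuel.Schanuel.Theses.RootDecomp1C.UnitarySchanuel) {n : ℕ} {z : Fin n → ℂ}
    (hz : LinearIndependent ℚ z)
    (hztr : Algebra.trdeg ℚ ↥(adjoin ℚ (Set.range z ∪ Set.range (Complex.exp ∘ z))) < (n : Cardinal))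
    (hmin : ∀ (k : ℕ), k < n → ∀ (w : Fin k → ℂ), LinearIndependent ℚ w →
      (∀ i, w i ∈ Submodule.span ℚ (Set.range z)) →
      (k : Cardinal) ≤ Algebra.trdeg ℚ ↥(adjoin ℚ (Set.range w ∪ Set.range (Complex.exp ∘ w)))) :
    ∀ i, (z i).re = 0 := by
  classical
  let ofRealQ : ℝ →ₗ[ℚ] ℂ :=
    Literature.ModelTheory.ExponentialFields.ExponentialRingHom.realComplex.toRingHom.toRatAlgHom.toLinearMap
  have ofRealQ_apply : ∀ t : ℝ, ofRealQ t = (t : ℂ) := fun t => rfl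
  let mulIQ : ℝ →ₗ[ℚ] ℂ := (LinearMap.mulRight ℚ Complex.I).comp ofRealQ
  have mulIQ_apply : ∀ t : ℝ, mulIQ t = (t : ℂ) * Complex.I := fun t => rfl
  have mulIQ_inj : Function.Injective mulIQ := fun a b hab => by
    have h1 : ((a : ℝ) : ℂ) * Complex.I = ((b : ℝ) : ℂ) * Complex.I := by
      rw [← mulIQ_apply, ← mulIQ_apply]; exact hab
    exact Complex.ofReal_injective (mul_right_cancel₀ Complex.I_ne_zero h1)
  unfold Summit.Schanuel.Schanuel.Theses.RootDecomp1C.UnitarySchanuel at hUn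
  push Not at hUn
  obtain ⟨m', r', hr', hr'tr⟩ := hUn
  let x' : Fin m' → ℂ := fun j => ((r' j : ℝ) : ℂ) * Complex.I
  have hx'li : LinearIndependent ℚ x' := by
    have : x' = ⇑mulIQ ∘ r' := by funext j; rfl
    rw [this]
    exact hr'.map' mulIQ (LinearMap.ker_eq_bot.mpr mulIQ_inj)
  have hx'tr : Algebra.trdeg ℚ ↥(adjoin ℚ (Set.range x' ∪ Set.range (Complex.exp ∘ x'))) < (m' : Cardinal) :=
    hr'tr
  have hzx' : Submodule.span ℚ (Set.range z) ≤ Submodule.span ℚ (Set.range x') :=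
    span_le_of_atom_of_failure hD hz hztr hmin hx'li hx'tr
  have hVx' : Submodule.span ℚ (Set.range x') ≤ LinearMap.range mulIQ :=
    Submodule.span_le.mpr (by rintro _ ⟨j, rfl⟩; exact LinearMap.mem_range.mpr ⟨r' j, rfl⟩)
  intro i
  obtain ⟨t', ht'⟩ := LinearMap.mem_range.mp (hVx' (hzx' (Submodule.subset_span ⟨i, rfl⟩)))
  rw [← ht', mulIQ_apply]; simp

/-- **Mixed cell (no `B` needed).**  If `RealSchanuel` and `UnitarySchanuel` both HOLD, every failure (axis or not)
has a non-real AND a non-imaginary coordinate — so on the `Real ∧ Unitary` side of the forest the residual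
`Cᵉ∟` lives entirely in the MIXED axis cell (1C's `MixedInductionStep` territory; under `B` the atom is moreover a
GLOBAL first failure by `atom_first_failure`, i.e. exactly 1C's first-failure object). -/
theorem failure_mixed_of_real_unitary (hRe : Summit.Schanuel.Schanuel.Theses.RootDecomp1C.RealSchanuel)
    (hUn : Summit.Schanuel.Schanuel.Theses.RootDecomp1C.UnitarySchanuel) {n : ℕ} {z : Fin n → ℂ}
    (hz : LinearIndependent ℚ z)
    (hztr : Algebra.trdeg ℚ ↥(adjoin ℚ (Set.range z ∪ Set.range (Complex.exp ∘ z))) < (n : Cardinal)) :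
    (∃ i, (z i).im ≠ 0) ∧ (∃ j, (z j).re ≠ 0) := by
  classical
  let ofRealQ : ℝ →ₗ[ℚ] ℂ :=
    Literature.ModelTheory.ExponentialFields.ExponentialRingHom.realComplex.toRingHom.toRatAlgHom.toLinearMap
  have ofRealQ_apply : ∀ t : ℝ, ofRealQ t = (t : ℂ) := fun t => rfl
  let mulIQ : ℝ →ₗ[ℚ] ℂ := (LinearMap.mulRight ℚ Complex.I).comp ofRealQ
  have mulIQ_apply : ∀ t : ℝ, mulIQ t = (t : ℂ) * Complex.I := fun t => rfl
  constructor
  · -- if every coordinate were real, `z` would be a real failure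
    by_contra hall
    push Not at hall
    let r : Fin n → ℝ := fun i => (z i).re
    have hzr : z = fun i => ((r i : ℝ) : ℂ) := by
      funext i; apply Complex.ext <;> simp [r, hall i]
    have hr : LinearIndependent ℚ r := by
      have hcomp : (⇑ofRealQ ∘ r) = z := by funext i; rw [Function.comp_apply, ofRealQ_apply, hzr]
      exact LinearIndependent.of_comp ofRealQ (hcomp ▸ hz)
    have h1 := hRe n r hr
    have h2 := Literature.ModelTheory.ExponentialFields.ExponentialRingHom.realComplex.lift_trdeg_adjoin_eq r
    simp only [Cardinal.lift_id] at h2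
    rw [h2] at h1
    have h3 : (n : Cardinal) ≤ Algebra.trdeg ℚ ↥(adjoin ℚ (Set.range z ∪ Set.range (Complex.exp ∘ z))) := by
      rw [hzr]; exact h1
    exact absurd hztr (not_lt_of_ge h3)
  · -- if every coordinate were imaginary, `z` would be a unitary failure
    by_contra hall
    push Not at hall
    let r : Fin n → ℝ := fun i => (z i).im
    have hzr : z = fun i => ((r i : ℝ) : ℂ) * Complex.I := by
      funext i; apply Complex.ext <;> simp [r, hall i]
    have hr : LinearIndependent ℚ r := by
      have hcomp : (⇑mulIQ ∘ r) = z := by funext i; rw [Function.comp_apply, mulIQ_apply, hzr]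
      exact LinearIndependent.of_comp mulIQ (hcomp ▸ hz)
    have h1 := hUn n r hr
    have h3 : (n : Cardinal) ≤ Algebra.trdeg ℚ ↥(adjoin ℚ (Set.range z ∪ Set.range (Complex.exp ∘ z))) := by
      rw [hzr]; exact h1
    exact absurd hztr (not_lt_of_ge h3)

end Summit.Schanuel.Schanuel.Theorems.RootDecomp1AtomRigidity
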